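import Mathlib

/-!
# AtomicCalibrationR (stmt-QuantumFields-28169), E2 `stub_offDiagonalWhitney` — real and imaginary parts of a complex test function
# (Plan A step 4 "Gp := (Re F or Im F) · Ψ, κ := 1 or I"; prover w4 g22, free hands)

`WhitneyPkg` asks for REAL pieces `Gp j` with complex coefficients `κ j`, `‖κ j‖ ≤ 1`, summing to the complex `F`.  The split is
`F = Re F + I · Im F`; this file records that `Re ∘ F`, `Im ∘ F` are `C^∞` with derivative norms bounded by those of `F`
(`Complex.reCLM`, `Complex.imCLM` have norm `1`), so every flatness / decay bound for `F` transfers verbatim.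

* `contDiff_re_comp`, `contDiff_im_comp`; `norm_iteratedFDeriv_re_comp_le`, `norm_iteratedFDeriv_im_comp_le`;
* `re_add_I_mul_im` — the pointwise recombination `((F x).re : ℂ) + I * (F x).im = F x` in the `κ · (Gp : ℂ)` shape.

Mathlib only; no stub/crux/rung/summit is closed; nothing here touches Yang–Mills; the YM mass gap is NOT proved. [folklore]
-/

set_option autoImplicit false

noncomputable section

open scoped ContDiff

namespace Summit.QuantumFields.YangMills.Cruxes.AtomicCalibrationR.RealImag

variable {X : Type*} [NormedAddCommGroup X] [NormedSpace ℝ X]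

/-- `Re ∘ F` is `C^∞`. -/
theorem contDiff_re_comp {F : X → ℂ} (hF : ContDiff ℝ ∞ F) : ContDiff ℝ ∞ fun x => (F x).re :=
  Complex.reCLM.contDiff.comp hF

/-- `Im ∘ F` is `C^∞`. -/
theorem contDiff_im_comp {F : X → ℂ} (hF : ContDiff ℝ ∞ F) : ContDiff ℝ ∞ fun x => (F x).im :=
  Complex.imCLM.contDiff.comp hF

/-- `‖D^j (Re ∘ F)(x)‖ ≤ ‖D^j F(x)‖`. -/
theorem norm_iteratedFDeriv_re_comp_le {F : X → ℂ} (hF : ContDiff ℝ ∞ F) (j : ℕ) (x : X) :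
    ‖iteratedFDeriv ℝ j (fun x => (F x).re) x‖ ≤ ‖iteratedFDeriv ℝ j F x‖ := by
  have hfun : (fun x => (F x).re) = Complex.reCLM ∘ F := rfl
  rw [hfun, ContinuousLinearMap.iteratedFDeriv_comp_left Complex.reCLM hF.contDiffAt
    (by exact_mod_cast le_top)]
  refine (ContinuousLinearMap.norm_compContinuousMultilinearMap_le _ _).trans ?_
  rw [Complex.reCLM_norm, one_mul]

/-- `‖D^j (Im ∘ F)(x)‖ ≤ ‖D^j F(x)‖`. -/
theorem norm_iteratedFDeriv_im_comp_le {F : X → ℂ} (hF : ContDiff ℝ ∞ F) (j : ℕ) (x : X) :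
    ‖iteratedFDeriv ℝ j (fun x => (F x).im) x‖ ≤ ‖iteratedFDeriv ℝ j F x‖ := by
  have hfun : (fun x => (F x).im) = Complex.imCLM ∘ F := rfl
  rw [hfun, ContinuousLinearMap.iteratedFDeriv_comp_left Complex.imCLM hF.contDiffAt
    (by exact_mod_cast le_top)]
  refine (ContinuousLinearMap.norm_compContinuousMultilinearMap_le _ _).trans ?_
  rw [Complex.imCLM_norm, one_mul]

/-- Recombination in the `κ · (Gp : ℂ)` shape of `WhitneyPkg` (vii): `1 · Re F(x) + I · Im F(x) = F(x)`. -/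
theorem re_add_I_mul_im (w : ℂ) : (1 : ℂ) * ((w.re : ℝ) : ℂ) + Complex.I * ((w.im : ℝ) : ℂ) = w := by
  rw [one_mul, mul_comm]; exact Complex.re_add_im w

/-- A real piece times `Re`/`Im`: if `‖D^j F z‖ ≤ b j` for `j ≤ m` then the same holds for `Re ∘ F` and `Im ∘ F`. -/
theorem norm_iteratedFDeriv_re_im_le_of_le {F : X → ℂ} (hF : ContDiff ℝ ∞ F) {b : ℕ → ℝ} {m : ℕ} (z : X)
    (hb : ∀ j : ℕ, j ≤ m → ‖iteratedFDeriv ℝ j F z‖ ≤ b j) :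
    (∀ j : ℕ, j ≤ m → ‖iteratedFDeriv ℝ j (fun x => (F x).re) z‖ ≤ b j) ∧
      ∀ j : ℕ, j ≤ m → ‖iteratedFDeriv ℝ j (fun x => (F x).im) z‖ ≤ b j :=
  ⟨fun j hj => (norm_iteratedFDeriv_re_comp_le hF j z).trans (hb j hj),
    fun j hj => (norm_iteratedFDeriv_im_comp_le hF j z).trans (hb j hj)⟩

end Summit.QuantumFields.YangMills.Cruxes.AtomicCalibrationR.RealImag

end
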